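import Summits.ValiantsHypothesis.ValiantsHypothesis.Theorems.GrenetZeonDualUnipotentThreeHalvesHeavyTopHalfSpeed
import Summits.ValiantsHypothesis.ValiantsHypothesis.Theorems.GrenetZeonDualUnipotentThreeHalvesHeavyTopGradedFlag

/-!
# `GrenetZeon.DualUnipotentThreeHalves` (stmt-ValiantsHypothesis-24318), LINE β `half_speed`, stub K0
# `stub_flagCostWordLaw_of_halfSpeedLaw`: THE HALF-SPEED TRADEOFF LAW S⁺ IMPLIES S3b IN WORD CURRENCY

K0 hand val-port-2 g2 (director R291 (2) / desk g14 #330; line pen val-port-1 g3; skeleton `Cruxes/DualUnipotentThreeHalves/Lines/half_speed.lean`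
rev 2 @b0d7b1a23069, val-port-4 g2 / val-idea-30).  Statement = the stub verbatim over the (D) defs ✓ p659475 (`HalfSpeedLaw`) and
`…WordDefs` (`FlagCostWordLaw`, `WordCheap`); the pen wires `stub_flagCostWordLaw_of_halfSpeedLaw := HalfSpeed.flagCostWordLaw_of_halfSpeedLaw`.

MATHEMATICS (val-port-4 g2's food table 19:21:32Z, val-idea-30's card).  Given the S⁺ constant `C`, take `C₀ = 64(C+1)`, `n₀ = 64(C+1)`.
For an affine nilpotent pencil `N` in the regime let `T₀` be its top map, `U = ℂ·N(0) + range T₀` (a nilpotent space, ✓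
`isNilpotent_of_mem_span_sup_range`), `Θ = min(m, n/4)`; S⁺ gives `T ≤ U` with `Θ·(dim U − dim T) ≤ C m²` and `HalfSpeed Θ U T`; put
`K = T₀⁻¹(T)`.  Then `dim K ≥ n² − (dim U − dim T)` (`finrank_le_finrank_comap_add`, through the quotient map `U → U/T`), every value
`N(x) = N(0) + T₀ x` lies in `U`, and ✓ `wordCheap_of_halfSpeed` closes once `((Θ + n − 1)/2 + 1)·n < dim K` — the arithmetic
`budget_of_regime` (cases `Θ = n/4 ≤ m`: `8·(dim U − dim T) < n²`; `Θ = m < n/4`: `dim U − dim T ≤ C m < C n/4`).  The corner `m = 0` is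
`wordCheap_zero` (every `0 × 0` word vanishes).

Honest framing.  K0 is bookkeeping (`--supports stmt-ValiantsHypothesis-24318 --as helper`): it proves `HalfSpeedLaw → FlagCostWordLaw` and
NOTHING about `HalfSpeedLaw`, `HalfSpeedIrrLaw`, R2 `HeavyTopLaw`, the crux, 8062 or `VP ≠ VNP` — all OPEN / NOT proved. [line β food table]
-/

set_option linter.dupNamespace false
set_option autoImplicit false

noncomputable section

namespace Summit.ValiantsHypothesis.ValiantsHypothesis.Theorems.GrenetZeon.HalfSpeed

open MvPolynomial Matrix
open scoped BigOperators
open Summit.ValiantsHypothesis.ValiantsHypothesis.Cruxes.TwoDimCoefficients.DimTwoCases (AffMat IsAffine)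
open Summit.ValiantsHypothesis.ValiantsHypothesis.Theorems.GrenetZeon.RadicalSplit
open Summit.ValiantsHypothesis.ValiantsHypothesis.Theorems.GrenetZeon.HeavyTopGradedFlag (isNilpotent_of_mem_span_sup_range)

/-! ## §1 Linear algebra: the preimage of a subspace of small codimension is large -/

/-- **Preimage dimension.**  For a linear map `f : V → M` with `range f ≤ U` and `T ≤ U`:
`dim V ≤ dim f⁻¹(T) + (dim U − dim T)`. -/
theorem finrank_le_finrank_comap_add {V M : Type*} [AddCommGroup V] [Module ℂ V] [FiniteDimensional ℂ V]
    [AddCommGroup M] [Module ℂ M] [FiniteDimensional ℂ M]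
    (f : V →ₗ[ℂ] M) (U T : Submodule ℂ M) (hTU : T ≤ U) (hfU : LinearMap.range f ≤ U) :
    Module.finrank ℂ V ≤ Module.finrank ℂ (T.comap f) + (Module.finrank ℂ U - Module.finrank ℂ T) := by
  -- g = (quotient by T) ∘ f has kernel f⁻¹(T) and range inside the image of U in M/T
  let g : V →ₗ[ℂ] (M ⧸ T) := T.mkQ ∘ₗ f
  have hker : LinearMap.ker g = T.comap f := by
    rw [LinearMap.ker_comp, Submodule.ker_mkQ]
  have h1 := LinearMap.finrank_range_add_finrank_ker g
  rw [hker] at h1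
  -- the image of U in M/T has dimension dim U − dim T
  have h2 : Module.finrank ℂ (U.map T.mkQ) + Module.finrank ℂ T = Module.finrank ℂ U := by
    have h := LinearMap.finrank_range_add_finrank_ker (T.mkQ.domRestrict U)
    rw [LinearMap.range_domRestrict] at h
    have hk : LinearMap.ker (T.mkQ.domRestrict U) = T.comap U.subtype := by
      ext x; simp [LinearMap.mem_ker]
    rw [hk, (Submodule.comapSubtypeEquivOfLe hTU).finrank_eq] at h
    exact h
  have h3 : Module.finrank ℂ (LinearMap.range g) ≤ Module.finrank ℂ (U.map T.mkQ) := by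
    apply Submodule.finrank_mono
    rintro _ ⟨v, rfl⟩
    exact ⟨f v, hfU (LinearMap.mem_range_self f v), rfl⟩
  omega

/-! ## §2 The pencil's values lie in `U = ℂ·N(0) + range T₀` -/

/-- Every value `N(x) = N(0) + N_lin(x)` lies in `ℂ·N(0) + range T₀`. -/
theorem map_eval_mem_span_sup_range {n m : ℕ} (N : AffMat n m)
    (T₀ : (Fin n × Fin n → ℂ) →ₗ[ℂ] Matrix (Fin m) (Fin m) ℂ) (hT : ∀ v, T₀ v = linPart N v) (x : Fin n × Fin n → ℂ) :
    N.map (MvPolynomial.eval x) ∈ (ℂ ∙ N.map (MvPolynomial.eval 0)) ⊔ LinearMap.range T₀ := by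
  have h : N.map (MvPolynomial.eval x) = N.map (MvPolynomial.eval 0) + T₀ x := by
    rw [hT]; unfold linPart; abel
  rw [h]
  exact Submodule.add_mem_sup (Submodule.mem_span_singleton_self _) (LinearMap.mem_range_self T₀ x)

/-! ## §3 The corner `m = 0` -/

/-- For `m = 0` every pencil is word-cheap as soon as `n ≥ 2` (all `0 × 0` words vanish; `K = ⊤`, `k = 0`). -/
theorem wordCheap_zero {n : ℕ} (N : AffMat n 0) (hn : 2 ≤ n) : WordCheap n 0 N := by
  refine ⟨⊤, 0, ?_, fun x v _ => ⟨0, 1, 0, le_rfl, by simp, fun w hw => ?_⟩⟩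
  · rw [finrank_top, Module.finrank_fintype_fun_eq_card, Fintype.card_prod, Fintype.card_fin]
    nlinarith
  · exact absurd (Subsingleton.elim _ _) hw

/-! ## §4 Arithmetic of the regime -/

/-- **Budget, case `Θ = n/4 ≤ m`**: `16(n−3)·δ < n³` gives `8δ < n²`, whence `8δ + 8n < 3n²`. -/
theorem budget_case_quarter (C n m δ : ℕ) (hn : 64 * (C + 1) ≤ n) (hreg : 64 * (C + 1) * m ^ 2 < n ^ 3)
    (hlaw : (n / 4) * δ ≤ C * m ^ 2) : 8 * δ + 8 * n < 3 * n ^ 2 := by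
  have hq : n - 3 ≤ 4 * (n / 4) := by omega
  have h1 : (n - 3) * δ ≤ 4 * C * m ^ 2 := by
    calc (n - 3) * δ ≤ 4 * (n / 4) * δ := Nat.mul_le_mul_right δ hq
      _ = 4 * ((n / 4) * δ) := by ring
      _ ≤ 4 * (C * m ^ 2) := Nat.mul_le_mul_left 4 hlaw
      _ = 4 * C * m ^ 2 := by ring
  have h2 : 16 * ((n - 3) * δ) < n ^ 3 := by
    calc 16 * ((n - 3) * δ) ≤ 16 * (4 * C * m ^ 2) := Nat.mul_le_mul_left 16 h1
      _ = 64 * C * m ^ 2 := by ring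
      _ ≤ 64 * (C + 1) * m ^ 2 := by nlinarith
      _ < n ^ 3 := hreg
  have hn6 : 6 ≤ n := by omega
  have h3 : n ≤ 2 * (n - 3) := by omega
  -- 8 n δ ≤ 16 (n−3) δ < n³ ⇒ 8 δ < n²
  have h4 : 8 * n * δ < n ^ 3 := by
    calc 8 * n * δ ≤ 8 * (2 * (n - 3)) * δ := by
          exact Nat.mul_le_mul_right δ (Nat.mul_le_mul_left 8 h3)
      _ = 16 * ((n - 3) * δ) := by ring
      _ < n ^ 3 := h2
  have hnpos : 0 < n := by omega
  have h5 : 8 * δ < n ^ 2 := by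
    by_contra hge
    push Not at hge
    have : n ^ 2 * n ≤ 8 * δ * n := Nat.mul_le_mul_right n hge
    have e1 : n ^ 2 * n = n ^ 3 := by ring
    have e2 : 8 * δ * n = 8 * n * δ := by ring
    omega
  nlinarith

/-- **Budget, case `Θ = m < n/4`**: `δ ≤ C m < C n/4` gives `8δ + 8n < 3n²`. -/
theorem budget_case_small (C n m δ : ℕ) (hn : 64 * (C + 1) ≤ n) (hm : 1 ≤ m) (hmn : m < n / 4)
    (hlaw : m * δ ≤ C * m ^ 2) : 8 * δ + 8 * n < 3 * n ^ 2 := by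
  have h1 : δ ≤ C * m := by
    have : m * δ ≤ m * (C * m) := by
      calc m * δ ≤ C * m ^ 2 := hlaw
        _ = m * (C * m) := by ring
    exact Nat.le_of_mul_le_mul_left this (by omega)
  have h2 : 4 * m < n := by omega
  have h3 : 8 * δ ≤ 2 * C * n := by nlinarith
  nlinarith

/-- **The budget of the regime**: with `Θ ≤ n/4`, `((Θ + (n−1))/2 + 1)·n + δ < n²` whenever `8δ + 8n < 3n²`. -/
theorem budget_of_bound (n Θ δ : ℕ) (hΘ : Θ ≤ n / 4) (h : 8 * δ + 8 * n < 3 * n ^ 2) :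
    ((Θ + (n - 1)) / 2 + 1) * n + δ < n ^ 2 := by
  have h1 : 2 * ((Θ + (n - 1)) / 2) ≤ Θ + (n - 1) := Nat.mul_div_le _ 2
  have h2 : 4 * (n / 4) ≤ n := Nat.mul_div_le n 4
  have h3 : 8 * ((Θ + (n - 1)) / 2 + 1) ≤ 5 * n + 8 := by omega
  have h4 : 8 * (((Θ + (n - 1)) / 2 + 1) * n) ≤ (5 * n + 8) * n := by
    calc 8 * (((Θ + (n - 1)) / 2 + 1) * n) = (8 * ((Θ + (n - 1)) / 2 + 1)) * n := by ring
      _ ≤ (5 * n + 8) * n := Nat.mul_le_mul_right n h3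
  nlinarith

/-! ## §5 K0 -/

/-- ★ **K0: `HalfSpeedLaw → FlagCostWordLaw`** (the β line's bookkeeping stub, verbatim).  With the S⁺ constant `C`: `C₀ = n₀ = 64(C+1)`;
`U = ℂ·N(0) + range T₀`, `Θ = min m (n/4)`, `T` from S⁺, `K = T₀⁻¹(T)`, closed by ✓ `wordCheap_of_halfSpeed`. [this file] -/
theorem flagCostWordLaw_of_halfSpeedLaw : HalfSpeedLaw → FlagCostWordLaw := by
  classical
  rintro ⟨C, hC⟩
  refine ⟨64 * (C + 1), 64 * (C + 1), fun n hn m hreg N hN hnil => ?_⟩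
  rcases Nat.eq_zero_or_pos m with hm0 | hmpos
  · subst hm0
    exact wordCheap_zero N (by omega)
  -- the space U and the top map
  obtain ⟨T₀, hT₀⟩ := exists_topMap_linPart N hN
  set U : Submodule ℂ (Matrix (Fin m) (Fin m) ℂ) := (ℂ ∙ N.map (MvPolynomial.eval 0)) ⊔ LinearMap.range T₀ with hU
  have hUnil : ∀ A ∈ U, IsNilpotent A := fun A hA =>
    isNilpotent_of_mem_span_sup_range N hN hnil T₀ hT₀ A hA
  -- the height
  set Θ := min m (n / 4) with hΘ
  have hn16 : 16 ≤ n / 4 := by omega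
  have hΘ1 : 1 ≤ Θ := le_min hmpos (by omega)
  have hΘm : Θ ≤ m := min_le_left _ _
  have hΘq : Θ ≤ n / 4 := min_le_right _ _
  obtain ⟨T, hTU, hcodim, hHS⟩ := hC m U hUnil Θ hΘ1 hΘm
  -- the direction space K = T₀⁻¹(T) and its dimension
  have hrange : LinearMap.range T₀ ≤ U := by rw [hU]; exact le_sup_right
  have hV : Module.finrank ℂ (Fin n × Fin n → ℂ) = n ^ 2 := by
    rw [Module.finrank_fintype_fun_eq_card, Fintype.card_prod, Fintype.card_fin, sq]
  have hdimK : n ^ 2 ≤ Module.finrank ℂ (T.comap T₀) + (Module.finrank ℂ U - Module.finrank ℂ T) := by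
    have h := finrank_le_finrank_comap_add T₀ U T hTU hrange
    rwa [hV] at h
  -- the arithmetic
  have hbound : 8 * (Module.finrank ℂ U - Module.finrank ℂ T) + 8 * n < 3 * n ^ 2 := by
    rcases le_or_gt (n / 4) m with hle | hlt
    · have hΘeq : Θ = n / 4 := min_eq_right hle
      exact budget_case_quarter C n m _ hn hreg (by simpa only [hΘeq] using hcodim)
    · have hΘeq : Θ = m := min_eq_left hlt.le
      exact budget_case_small C n m _ hn hmpos hlt (by simpa only [hΘeq] using hcodim)
  have hbudget := budget_of_bound n Θ _ hΘq hbound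
  refine wordCheap_of_halfSpeed N (U : Set (Matrix (Fin m) (Fin m) ℂ)) (T : Set (Matrix (Fin m) (Fin m) ℂ)) Θ hHS
    (fun x => map_eval_mem_span_sup_range N T₀ hT₀ x) (T.comap T₀) (fun v hv => ?_) ?_
  · -- v ∈ T₀⁻¹(T): its top lies in T
    have h : T₀ v ∈ T := hv
    rw [hT₀] at h
    exact h
  · omega

end Summit.ValiantsHypothesis.ValiantsHypothesis.Theorems.GrenetZeon.HalfSpeed

end
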